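import Literature.AnabelianGeometry.EtaleTheta.SettingModelKrullTate2
import Literature.AnabelianGeometry.EtaleTheta.SettingModel2CommutatorCuspOrigin
import Literature.AnabelianGeometry.EtaleTheta.SettingModelKrullCuspLaws
import HarnessLib

/-!
# `ThetaSetting.IsThm16Origin` HOLDS at the cusped untwisted Krull model `modelκ′` — the FIRST inhabitant of the
# hypothesis bundle of the K3 chain ([EtTh] Thm. 1.6 (i) from origin clauses)

Mochizuki, *The étale theta function …*, Publ. RIMS **45** (2009) [EtTh], §1 pp. 12–13 [cite: MochizukiEtTh2009, §1 p.13]: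
«`Π^tp_Y` … `Z`» (R1), «any decomposition group of a cusp of `Y^log` determines … a section `G_K → (Π^tp_Y)^ell`
… an open immersion `G_{K_N} ↪ (Π^tp_Y)^ell/N·(Δ^tp_Y)^ell` … a Galois covering `Y_N → Y`» (R2), «the quotients
`Π^tp_X ↠ (Π^tp_X)^Θ ↠ (Π^tp_X)^ell`» (R3), «`G_{K_N}` acts trivially on `(Δ^tp_X)^ell/N·(Δ^tp_Y)^ell`» (TM); Thm. 1.6
(i) p. 24. Cell abc-iut, layer L2 (NV lane, origin-profile lineage of abc-iut-w5-d051), seat abc-iut-w5-d165 (gen 4),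
row «ISTHM16ORIGIN@modelκ′» (STATUS 11:17Z), PART 2 over abc-iut-L2-t10's K3 `SettingModelKrullCusp`
(`ThetaSetting.modelκ′ p`: the untwisted Krull carrier `Γ ⋊_{θ∘1} G_{ℚ_p}` WITH the commutator-axis cusp
`D_x = c^Ẑ ⋊ G_{ℚ_p}` of this seat's `SettingModel2CommutatorCusp`) and this seat's PART 1 `SettingModelKrullTate2`.

THE MODEL ZOO BEFORE THIS FILE (abc-iut-w5-d051's `stageTwo_origin_fields`, `SettingModelTateCuspOriginProfile`,
`SettingModelChiOriginProfile`, `SettingModelOriginProfile`; this seat's `model₂c_origin_profile`): `IsThm16Origin` FAILS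
at `model`/`model₂`/`model₂ᶜ` (discrete Galois factor: R1), at `modelχ`/`modelχq`/`modelκ` (no cusp), at
`modelχ′`/`modelχq′` (TORAL cusp: R2 fails for `N ≥ 2`) — «the residual is exactly the cusp AXIS». HERE:

* §1 transport from `modelκ` (same carriers; the record differs only in the cusp fields): TM₂ `modelκ'_tate2`, R1
  `kerToZIsCompactlyGenerated_modelκ'`, R3, `modelκ'_gknIsKernelOfAction_two`;
* §2 the cuspidal decomposition groups of `modelκ′` are the `{g | g.left ∈ γ₀ c^Ẑ γ₀⁻¹}` and lie in `Π^tp_Y` ⇒ the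
  CUSP CLAUSE `exists_cuspidal_le_GtpY_modelκ'`;
* §3 **R2 `modelκ'_gtpYNFromCusp` for EVERY `N`** (port of this seat's `model₂c_gtpYNFromCusp`: the commutator-axis
  inertia dies in `(Π^tp_X)^ell`, the level-`N` `y`-profile homomorphism kills the cusp image and `N·(Δ^tp_Y)^ell`, and
  `y_N(γ) = 0 ⇒ γ ≡ (b^s)^N`);
* §4 **`ThetaSetting.modelκ'_isThm16Origin`** and **`ThetaSetting.exists_isEtThOrigin_and_isThm16Origin`** — guard +
  ALL SIX fields of `IsThm16Origin` jointly inhabited for the first time; `modelκ'_origin_profile` adds abc-iut-L2-t7's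
  census bundle `CuspLaws` (C3 / C9 / C16 at `modelκ′`, `SettingModelKrullCuspLaws`, consumed BY NAME).

HONEST LABEL: SEMI-SYNTHETIC model (untwisted Krull: trivial Galois action on `Γ`, `K = ℚ_p`, `q_X = p²`; consistency
evidence for the hypothesis bundle `IsEtThOrigin ∧ IsThm16Origin`, nothing more — `IsTateOrigin` for all `N` is NOT
claimed and fails as at `modelχ`); nothing of [EtTh] asserted; no side taken on [IUTchIII] Cor. 3.12; typed ≠ proved.
PROOF-ONLY (0 definitions; nothing of abc-iut-L2-t10's K-files restated).
-/

noncomputable section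

namespace Literature.AnabelianGeometry.EtaleTheta.SettingModel

open Literature.AnabelianGeometry.SemiGraphs Thm16Sub Function _root_.Topology
open scoped commutatorElement Pointwise

variable (p : ℕ) [Fact p.Prime]

/-! ## §1. The cusp-free clauses transported from `modelκ` -/

/-- TM₂ at `modelκ′` (transport of `modelκ_tate2`: the clause does not read the cusp). [cite: MochizukiEtTh2009, §1 p.13] -/
theorem modelκ'_tate2 :
    ∃ (y₁ z : (ThetaSetting.modelκ' p).PiTemp) (ζ r : PadicAlgCl p),
      y₁ ∈ (ThetaSetting.modelκ' p).DtpY ∧ z ∈ (ThetaSetting.modelκ' p).DeltaTemp ∧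
      (ThetaSetting.modelκ' p).toZ z = Multiplicative.ofAdd 1 ∧
      IsPrimitiveRoot ζ ((2 : ℕ+) : ℕ) ∧ r ^ ((2 : ℕ+) : ℕ) = (ThetaSetting.modelκ' p).qX ∧
      (∀ y ∈ (ThetaSetting.modelκ' p).DtpY, ∃ k : ℕ,
        toEll (ThetaSetting.modelκ' p) y * (toEll (ThetaSetting.modelκ' p) y₁ ^ k)⁻¹ ∈
          ellPowersY (ThetaSetting.modelκ' p) 2) ∧
      (∀ k : ℕ, toEll (ThetaSetting.modelκ' p) y₁ ^ k ∈ ellPowersY (ThetaSetting.modelκ' p) 2 ↔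
        ((2 : ℕ+) : ℕ) ∣ k) ∧
      (∀ (g : (ThetaSetting.modelκ' p).PiTemp) (k : ℕ), (ThetaSetting.modelκ' p).aug g ζ = ζ ^ k →
        ∀ y ∈ (ThetaSetting.modelκ' p).DtpY,
          toEll (ThetaSetting.modelκ' p) (g * y * g⁻¹) * (toEll (ThetaSetting.modelκ' p) y ^ k)⁻¹ ∈
            ellPowersY (ThetaSetting.modelκ' p) 2) ∧
      (∀ (g : (ThetaSetting.modelκ' p).PiTemp) (m : ℕ), (ThetaSetting.modelκ' p).aug g r = ζ ^ m * r →
        toEll (ThetaSetting.modelκ' p) (g * z * g⁻¹ * z⁻¹) * (toEll (ThetaSetting.modelκ' p) y₁ ^ m)⁻¹ ∈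
          ellPowersY (ThetaSetting.modelκ' p) 2) :=
  modelκ_tate2 p

/-- R1 at `modelκ′` (transport). [cite: MochizukiEtTh2009, §1 p.12] -/
theorem kerToZIsCompactlyGenerated_modelκ' : KerToZIsCompactlyGenerated (ThetaSetting.modelκ' p) :=
  kerToZIsCompactlyGenerated_modelκ p

/-- R3, first half, at `modelκ′` (transport). [cite: MochizukiEtTh2009, §1 p.12] -/
theorem isQuotientMap_toTheta_modelκ' : IsQuotientMap (ThetaSetting.modelκ' p).toTheta :=
  QuotientGroup.isQuotientMap_mk (CurveTheta.thetaKer (curveκ' p))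

/-- R3, second half, at `modelκ′` (transport). [cite: MochizukiEtTh2009, §1 p.12] -/
theorem isQuotientMap_thetaToEll_modelκ' : IsQuotientMap (ThetaSetting.modelκ' p).thetaToEll :=
  isQuotientMap_thetaToEll_modelκ p

/-- `G_{K_2} = Ker(G_K ↷ (Δ^tp_X)^ell/2·(Δ^tp_Y)^ell)` at `modelκ′` (transport). [cite: MochizukiEtTh2009, §1 p.13] -/
theorem modelκ'_gknIsKernelOfAction_two : GKNIsKernelOfAction (ThetaSetting.modelκ' p) 2 :=
  modelκ_gknIsKernelOfAction_two p

/-! ## §2. The cuspidal decomposition groups of `modelκ′` -/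

/-- Conjugating the cusp datum inside `Γ ⋊_{θ∘1} G_{ℚ_p}` (TRIVIAL action): `h · D_x · h⁻¹ = {g | g.left ∈ h.left c^Ẑ h.left⁻¹}`.
[cite: MochizukiEtTh2009, §1 p.13] -/
theorem mem_conjAct_smul_cuspDecompκ_iff (h : ConjAct (PiTpκ p)) (g : PiTpκ p) :
    g ∈ h • cuspDecompκ p ↔ g.left ∈ MulAut.conj (ConjAct.ofConjAct h).left • cAxisGfp := by
  rw [Subgroup.mem_smul_pointwise_iff_exists, Subgroup.mem_smul_pointwise_iff_exists]
  constructor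
  · rintro ⟨d, hd, rfl⟩
    refine ⟨d.left, (mem_cuspDecompκ_iff p d).mp hd, ?_⟩
    rw [ConjAct.smul_def, MulAut.smul_def, MulAut.conj_apply, SemidirectProduct.mul_left, SemidirectProduct.mul_left,
      SemidirectProduct.inv_left]
    simp only [actκ_apply_eq]
  · rintro ⟨c, hc, hcg⟩
    refine ⟨(ConjAct.ofConjAct h)⁻¹ * g * ConjAct.ofConjAct h, ?_, ?_⟩
    · rw [mem_cuspDecompκ_iff, SemidirectProduct.mul_left, SemidirectProduct.mul_left, SemidirectProduct.inv_left]
      simp only [actκ_apply_eq]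
      rw [MulAut.smul_def, MulAut.conj_apply] at hcg
      have : (ConjAct.ofConjAct h).left⁻¹ * g.left * (ConjAct.ofConjAct h).left = c := by
        rw [← hcg]; group
      rw [this]; exact hc
    · rw [ConjAct.smul_def]; group

/-- **Every cuspidal decomposition group of `modelκ′` lies in `Π^tp_Y`** (the commutator axis has `a`-degree `0`).
[cite: MochizukiEtTh2009, §1 p.13] -/
theorem cuspidal_le_GtpY_modelκ' {Dc : Subgroup (PiTpκ p)}
    (hDc : (ThetaSetting.modelκ' p).IsCuspidalDecompositionGroup Dc) : Dc ≤ (ThetaSetting.modelκ' p).GtpY := by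
  obtain ⟨_, -, h, rfl⟩ := hDc
  intro g hg
  change g ∈ h • cuspDecompκ p at hg
  rw [mem_conjAct_smul_cuspDecompκ_iff] at hg
  change g ∈ ((krullTwistData p).toZ).ker
  rw [MonoidHom.mem_ker, GfpTwistData.toZ_apply]
  exact conj_cAxisGfp_le_ker_gfpSnd _ hg

/-- **The cusp clause of `IsThm16Origin` HOLDS at `modelκ′`.** [cite: MochizukiEtTh2009, §1 p.13] -/
theorem exists_cuspidal_le_GtpY_modelκ' :
    ∃ Dc : Subgroup (ThetaSetting.modelκ' p).PiTemp,
      (ThetaSetting.modelκ' p).IsCuspidalDecompositionGroup Dc ∧ Dc ≤ (ThetaSetting.modelκ' p).GtpY :=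
  ⟨cuspDecompκ p, ⟨(), trivial, 1, by rw [one_smul]⟩, cuspidal_le_GtpY_modelκ' p ⟨(), trivial, 1, by rw [one_smul]⟩⟩

/-! ## §3. R2 at `modelκ′`, for every `N` -/

/-- Two `inl`-elements have the same ell-image iff all their `(x, y)`-level coordinates agree; on `Ker pr₂` the
`x`-coordinates vanish, so only `y` counts. [cite: MochizukiEtTh2009, §1 p.13] -/
theorem toEll_inl_eq_iff_κ {γ γ' : Gfp} (hγ : γ ∈ gfpSnd.ker) (hγ' : γ' ∈ gfpSnd.ker) :
    toEll (ThetaSetting.modelκ' p) (SemidirectProduct.inl γ) = toEll (ThetaSetting.modelκ' p) (SemidirectProduct.inl γ') ↔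
      ∀ N : ℕ+, (levelHom N γ).y = (levelHom N γ').y := by
  change toEll (ThetaSetting.modelκ p) (SemidirectProduct.inl γ) = toEll (ThetaSetting.modelκ p) (SemidirectProduct.inl γ') ↔ _
  rw [toEll_modelκ_eq_iff, ← map_inv, ← map_mul, mem_ellKer_curveκ_iff, SemidirectProduct.left_inl,
    SemidirectProduct.right_inl]
  have hk : γ⁻¹ * γ' ∈ gfpSnd.ker := gfpSnd.ker.mul_mem (gfpSnd.ker.inv_mem hγ) hγ'
  constructor
  · rintro ⟨h, -⟩ N
    have hy := (h N).2
    change (levelHom N (γ⁻¹ * γ')).y = 0 at hy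
    simp only [map_mul, map_inv, Heis.mul_y, Heis.inv_y] at hy
    linear_combination -hy
  · intro h
    refine ⟨fun N => ⟨levelHom_x_eq_zero hk, ?_⟩, rfl⟩
    change (levelHom N (γ⁻¹ * γ')).y = 0
    simp only [map_mul, map_inv, Heis.mul_y, Heis.inv_y, h N]
    ring

/-- **`N`-th powers modulo `Ker toEll`** at `modelκ′`: `γ ∈ Ker pr₂` with `y_N(γ) = 0` has the ell-image of
`(inl b^s)^N` for some `s ∈ Ẑ`. [cite: MochizukiEtTh2009, §1 p.13] -/
theorem exists_toEll_inl_eq_pow_κ (N : ℕ+) {γ : Gfp} (hγ : γ ∈ gfpSnd.ker) (hy : (levelHom N γ).y = 0) :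
    ∃ s : ZH, toEll (ThetaSetting.modelκ' p) (SemidirectProduct.inl γ) =
      toEll (ThetaSetting.modelκ' p) (SemidirectProduct.inl (bPowGfp s)) ^ (N : ℕ) := by
  obtain ⟨t, ht⟩ := exists_zHat_forall_hHat_y_eq (gfpFst γ)
  have htN : ZHatLevel.level N t = 1 := by
    rw [← modN_eq_level, ← ofAdd_toAdd (modN N t), ht N]
    change Multiplicative.ofAdd (levelHom N γ).y = 1
    rw [hy, ofAdd_zero]
  obtain ⟨s, hs⟩ := (ZHatLevel.level_eq_one_iff_exists_pow N t).mp htN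
  refine ⟨s, ?_⟩
  rw [← map_pow, ← map_pow, toEll_inl_eq_iff_κ p hγ (gfpSnd.ker.pow_mem (bPowGfp_mem_ker_gfpSnd s) _)]
  intro M
  rw [map_pow]
  change (hHat M (gfpFst γ)).y = ((levelHom M (bPowGfp s)) ^ (N : ℕ)).y
  have hpow : ∀ (h : Heis (ZMod M)) (n : ℕ), (h ^ n).y = n • h.y := by
    intro h n
    induction n with
    | zero => simp
    | succ n ih => rw [pow_succ, Heis.mul_y, ih, succ_nsmul]
  rw [hpow, levelHom_y_bPowGfp, ← ht M, modN_eq_level, ← hs, map_pow, toAdd_pow]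

/-- Elements of `Δ^tp_Y` at `modelκ′` are `inl γ` with `γ ∈ Ker pr₂`. [cite: MochizukiEtTh2009, §1 p.13] -/
theorem mem_dtpY_modelκ'_iff (g : PiTpκ p) :
    g ∈ (ThetaSetting.modelκ' p).DtpY ↔ g.left ∈ gfpSnd.ker ∧ g.right = 1 := by
  change g ∈ ((krullTwistData p).toZ).ker ⊓ (curveκ' p).DeltaTemp ↔ _
  rw [Subgroup.mem_inf, MonoidHom.mem_ker, GfpTwistData.toZ_apply, curveκ'_deltaTemp, mem_deltaTempκ_iff]
  exact Iff.rfl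

/-- **`N·(Δ^tp_Y)^ell` in coordinates** at `modelκ′`: `w ∈ ellPowersY N ↔ w = toEll(inl δ)^N`, `δ ∈ Ker pr₂`.
[cite: MochizukiEtTh2009, §1 p.13] -/
theorem mem_ellPowersY_modelκ'_iff (N : ℕ+) (w : (ThetaSetting.modelκ' p).GtpEll) :
    w ∈ ellPowersY (ThetaSetting.modelκ' p) N ↔
      ∃ δ : Gfp, δ ∈ gfpSnd.ker ∧ w = toEll (ThetaSetting.modelκ' p) (SemidirectProduct.inl δ) ^ (N : ℕ) := by
  have hcomm : ∀ δ₁ δ₂ : Gfp, δ₁ ∈ gfpSnd.ker → δ₂ ∈ gfpSnd.ker →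
      Commute (toEll (ThetaSetting.modelκ' p) (SemidirectProduct.inl δ₁))
        (toEll (ThetaSetting.modelκ' p) (SemidirectProduct.inl δ₂)) := by
    intro δ₁ δ₂ h₁ h₂
    rw [Commute, SemiconjBy, ← map_mul, ← map_mul, ← map_mul, ← map_mul,
      toEll_inl_eq_iff_κ p (gfpSnd.ker.mul_mem h₁ h₂) (gfpSnd.ker.mul_mem h₂ h₁)]
    intro M
    simp only [map_mul, Heis.mul_y]
    ring
  constructor
  · intro hw
    refine Subgroup.closure_induction (p := fun w _ => ∃ δ : Gfp, δ ∈ gfpSnd.ker ∧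
        w = toEll (ThetaSetting.modelκ' p) (SemidirectProduct.inl δ) ^ (N : ℕ)) ?_ ?_ ?_ ?_ hw
    · rintro _ ⟨_, ⟨g, hg, rfl⟩, rfl⟩
      obtain ⟨h1, h2⟩ := (mem_dtpY_modelκ'_iff p g).mp hg
      refine ⟨g.left, h1, ?_⟩
      rw [← eq_inl_of_right_eq_one_κ h2]
    · exact ⟨1, one_mem _, by rw [map_one, map_one, one_pow]⟩
    · rintro _ _ _ _ ⟨δ₁, h₁, rfl⟩ ⟨δ₂, h₂, rfl⟩
      refine ⟨δ₁ * δ₂, gfpSnd.ker.mul_mem h₁ h₂, ?_⟩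
      rw [← (hcomm δ₁ δ₂ h₁ h₂).mul_pow, ← map_mul, ← map_mul]
    · rintro _ _ ⟨δ, hδ, rfl⟩
      refine ⟨δ⁻¹, gfpSnd.ker.inv_mem hδ, ?_⟩
      rw [← inv_pow, ← map_inv, ← map_inv]
  · rintro ⟨δ, hδ, rfl⟩
    refine Subgroup.subset_closure ⟨toEll (ThetaSetting.modelκ' p) (SemidirectProduct.inl δ),
      ⟨SemidirectProduct.inl δ, ?_, rfl⟩, rfl⟩
    exact (mem_dtpY_modelκ'_iff p _).mpr ⟨by rwa [SemidirectProduct.left_inl], SemidirectProduct.right_inl δ⟩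

/-- **R2 (`Thm16Sub.GtpYNFromCusp`) HOLDS at `modelκ′` for every `N`** — reading `Π^tp_{Y_N}` off a cusp section
returns abc-iut-L2-t10's `Π^tp_{Y_N} = Δ^tp_{Y_N} ⋊ G_{K_N}`, because the commutator-axis inertia dies in
`(Π^tp_X)^ell` (port of this seat's `model₂c_gtpYNFromCusp`). [cite: MochizukiEtTh2009, §1 p.13] -/
theorem modelκ'_gtpYNFromCusp (N : ℕ+) : GtpYNFromCusp (ThetaSetting.modelκ' p) N := by
  intro Dc hDc _ g
  obtain ⟨_, -, h, rfl⟩ := hDc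
  set γ₀ : Gfp := (ConjAct.ofConjAct h).left with hγ₀
  have hmem : ∀ d : PiTpκ p, d ∈ h • (ThetaSetting.modelκ' p).decomp () ↔ d.left ∈ MulAut.conj γ₀ • cAxisGfp :=
    fun d => mem_conjAct_smul_cuspDecompκ_iff p h d
  -- the level-`N` `y`-profile homomorphism on `Π^tp_X` (trivial action!) and on `(Π^tp_X)^ell`
  let yN : PiTpκ p →* Multiplicative (ZMod N) :=
    MonoidHom.mk' (fun d => Multiplicative.ofAdd (levelHom N d.left).y) fun a b => by
      show Multiplicative.ofAdd (levelHom N (a * b).left).y =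
        Multiplicative.ofAdd (levelHom N a.left).y * Multiplicative.ofAdd (levelHom N b.left).y
      rw [SemidirectProduct.mul_left, actκ_apply_eq, map_mul, Heis.mul_y, ofAdd_add]
  have hyN : ∀ d : PiTpκ p, yN d = Multiplicative.ofAdd (levelHom N d.left).y := fun _ => rfl
  have hker : CurveTheta.ellKer (curveκ p) ≤ yN.ker := by
    intro d hd
    have hy : (hHat N (gfpFst d.left)).y = 0 := (((mem_ellKer_curveκ_iff p d).mp hd).1 N).2
    rw [MonoidHom.mem_ker, hyN]
    change Multiplicative.ofAdd (hHat N (gfpFst d.left)).y = 1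
    rw [hy, ofAdd_zero]
  let yLevel : (ThetaSetting.modelκ' p).GtpEll →* Multiplicative (ZMod N) :=
    QuotientGroup.lift (CurveTheta.ellKer (curveκ p)) yN hker
  have hyLevel : ∀ d : PiTpκ p, yLevel (toEll (ThetaSetting.modelκ' p) d) = Multiplicative.ofAdd (levelHom N d.left).y := by
    intro d
    change yLevel (toEll (ThetaSetting.modelκ p) d) = _
    rw [toEll_modelκ_apply, QuotientGroup.mk'_apply]
    exact QuotientGroup.lift_mk _ hker d
  -- unfold the model's data: `Π^tp_{Y_N} = Δ^tp_{Y_N} ⋊ G_{K_N}`, `Π^tp_Y = Ker(pr₂ ∘ left)`, `aug = right`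
  change g ∈ YNκ p N ↔ g ∈ ((krullTwistData p).toZ).ker ∧ augκ p g ∈ (fieldKN (⊥ : IntermediateField ℚ_[p]
    (PadicAlgCl p)) (qModel p) N).fixingSubgroup ∧ _
  rw [YNκ, GfpTwistData.mem_YN, MonoidHom.mem_ker, GfpTwistData.toZ_apply, augκ_apply]
  constructor
  · rintro ⟨h1, h2⟩
    have h1' : g.left ∈ gfpSnd.ker := dY_le N h1
    refine ⟨h1', h2, ?_⟩
    -- `g = inr(g.right) · inl(g.left)` (trivial action), and `toEll` of each factor lies in the right summand
    have hsplit : g = (SemidirectProduct.inr g.right : PiTpκ p) * SemidirectProduct.inl g.left := by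
      refine SemidirectProduct.ext ?_ ?_
      · rw [SemidirectProduct.mul_left, SemidirectProduct.left_inr, SemidirectProduct.right_inr, actκ_apply_eq,
          SemidirectProduct.left_inl, one_mul]
      · rw [SemidirectProduct.mul_right, SemidirectProduct.right_inr, SemidirectProduct.right_inl, mul_one]
    rw [hsplit, map_mul]
    refine Subgroup.mul_mem_sup ?_ ?_
    · refine ⟨SemidirectProduct.inr g.right, Subgroup.mem_inf.mpr ⟨?_, ?_⟩, rfl⟩
      · rw [hmem, SemidirectProduct.left_inr]; exact one_mem _
      · exact h2
    · have hy : (levelHom N g.left).y = 0 := (Subgroup.mem_comap.mp (Subgroup.mem_inf.mp h1).2).2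
      obtain ⟨s, hs⟩ := exists_toEll_inl_eq_pow_κ p N h1' hy
      rw [hs]
      exact (mem_ellPowersY_modelκ'_iff p N _).mpr ⟨bPowGfp s, bPowGfp_mem_ker_gfpSnd s, rfl⟩
  · rintro ⟨h1, h2, h3⟩
    refine ⟨Subgroup.mem_inf.mpr ⟨h1, Subgroup.mem_comap.mpr ⟨levelHom_x_eq_zero h1, ?_⟩⟩, h2⟩
    -- the `y`-profile kills the cusp image and the `N`-th powers
    have hA : (((h • (ThetaSetting.modelκ' p).decomp ()) ⊓ ((ThetaSetting.modelκ' p).GKN N).comap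
        (ThetaSetting.modelκ' p).aug.toMonoidHom).map (toEll (ThetaSetting.modelκ' p))) ≤ yLevel.ker := by
      rintro _ ⟨d, hd, rfl⟩
      have hd1 : d.left ∈ MulAut.conj γ₀ • cAxisGfp := (hmem d).mp (Subgroup.mem_inf.mp hd).1
      rw [MonoidHom.mem_ker, hyLevel, levelHom_y_eq_zero_of_mem_conj_cAxisGfp N hd1, ofAdd_zero]
    have hB : ellPowersY (ThetaSetting.modelκ' p) N ≤ yLevel.ker := by
      intro w hw
      obtain ⟨δ, -, rfl⟩ := (mem_ellPowersY_modelκ'_iff p N w).mp hw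
      rw [MonoidHom.mem_ker, map_pow, hyLevel, ← ofAdd_nsmul, nsmul_eq_mul, ZMod.natCast_self, zero_mul,
        ofAdd_zero]
    have hg : toEll (ThetaSetting.modelκ' p) g ∈ yLevel.ker := sup_le hA hB h3
    rw [MonoidHom.mem_ker, hyLevel, ← ofAdd_zero] at hg
    exact Multiplicative.ofAdd.injective hg

/-! ## §4. `IsThm16Origin` at `modelκ′`, and the census laws C9 / C16 / C3 -/

/-- **`ThetaSetting.IsThm16Origin` HOLDS at the cusped untwisted Krull model `modelκ′`** — R1, R2 (all `N`), the cusp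
clause, R3 (both quotients) and TM₂ together. [cite: MochizukiEtTh2009, Thm 1.6 (i) p.24] -/
theorem _root_.Literature.AnabelianGeometry.EtaleTheta.ThetaSetting.modelκ'_isThm16Origin :
    (ThetaSetting.modelκ' p).IsThm16Origin where
  kerToZ_compactlyGenerated := kerToZIsCompactlyGenerated_modelκ' p
  gtpYN_fromCusp := modelκ'_gtpYNFromCusp p
  exists_cuspidal_le_GtpY := exists_cuspidal_le_GtpY_modelκ' p
  isQuotientMap_toTheta := isQuotientMap_toTheta_modelκ' p
  isQuotientMap_thetaToEll := isQuotientMap_thetaToEll_modelκ' p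
  tate2 := modelκ'_tate2 p

/-- **NON-VACUITY of the K3-chain hypothesis bundle**: there is a `ThetaSetting p` satisfying the guard `IsEtThOrigin`
AND the origin clauses `IsThm16Origin` (R1, R2, cusp, R3, TM₂) — the FIRST inhabitant in the tree (witness `modelκ′`;
semi-synthetic, consistency evidence only). [cite: MochizukiEtTh2009, Thm 1.6 (i) p.24] -/
theorem _root_.Literature.AnabelianGeometry.EtaleTheta.ThetaSetting.exists_isEtThOrigin_and_isThm16Origin :
    ∃ D : ThetaSetting p, D.IsEtThOrigin ∧ D.IsThm16Origin :=
  ⟨ThetaSetting.modelκ' p, ThetaSetting.modelκ'_isEtThOrigin p, ThetaSetting.modelκ'_isThm16Origin p⟩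

/-- **The joint origin profile of `modelκ′`**: guard ✓ · `IsThm16Origin` ✓ · abc-iut-L2-t7's `CuspLaws` ✓ (C3 /
C9 / C16, `cuspLaws_modelκ'`, `SettingModelKrullCuspLaws`) — the whole §1 cusp/origin-clause census is inhabited
TOGETHER at one model. [cite: MochizukiEtTh2009, §1 p.13] -/
theorem modelκ'_origin_profile :
    (ThetaSetting.modelκ' p).IsEtThOrigin ∧ (ThetaSetting.modelκ' p).IsThm16Origin ∧ (ThetaSetting.modelκ' p).CuspLaws :=
  ⟨ThetaSetting.modelκ'_isEtThOrigin p, ThetaSetting.modelκ'_isThm16Origin p, cuspLaws_modelκ' p⟩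

/-- **NON-VACUITY of «guard ∧ `IsThm16Origin` ∧ `CuspLaws`»** as an `∃`-statement over `ThetaSetting p`.
[cite: MochizukiEtTh2009, §1 p.13] -/
theorem _root_.Literature.AnabelianGeometry.EtaleTheta.ThetaSetting.exists_isEtThOrigin_isThm16Origin_cuspLaws :
    ∃ D : ThetaSetting p, D.IsEtThOrigin ∧ D.IsThm16Origin ∧ D.CuspLaws :=
  ⟨ThetaSetting.modelκ' p, modelκ'_origin_profile p⟩

end Literature.AnabelianGeometry.EtaleTheta.SettingModel

end
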